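import Literature.MathematicalPhysics.QuantumFieldTheory.Balaban1983to89.Beta.AveragedAFCarrierJsBalW2

/-!
# BalabanUV / Beta / AveragedAFCarrierJsBalT2 — the whole located [III] list OVER THE WALL'S LITERAL AFTER (P4) STAGE B,
# `D1Drift Lc (JsBalT2Of hLc cE cVH cΛ cE₂ cB T hB hmix) N μ ν`
# (pub-balaban β sub-cell, [III]-side CO-LEAD unit `b2b-balaban-strat-b14` gen 26; trigger (t1″) of MISSING-B14 §9.39 (e): an2
# `Beta.BalabanStepW2` v1.1 p194792 — the second-order tables made RECURSIVE, `T2Of`, and the literal `JsBalT2Of`)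

PLACEMENT.  A CELL RESULT (our own derived ENDs over our typed objects; nothing printed by Bałaban is reproduced), hence under the cell
topic `Summits/QuantumFields/BalabanUV/` per the β-lead's NOTICE (R34) (journal 2026-08-19) and the h21 placement rule; it IMPORTS the
Literature leaves it instantiates.  First [III] leaf of this lineage under the cell topic; its Stage-A sibling `AveragedAFCarrierJsBalW2`
(p194602) landed under `Literature/…/Beta/` minutes before (R34) and stays there (existing files are not moved).

VERSIONS
* v1 (this file; gen 26): §1 (D1) currency, §2 closed `Π`-form with the RECURSIVE second-order family `WbalT2Of … j` in the table
  slot, §3 Cauchy / limit currency (one END + carrier), §4 road B — over the Stage-B literal.  Theorems only; 0 `def`; 0 `def … : Prop`.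

HONEST FRAMING (page 1 of everything the β sub-cell writes): discharging `BetaPertH` makes Bałaban's UV stability UNCONDITIONAL — a
real constructive-QFT result; it is NOT the continuum limit and NOT the Clay problem.  THIS MODULE is CLASS-LEVEL BOOKKEEPING: it
instantiates `AveragedAFCarrierJsBalW2` (v1 p194602: the [III] list over the Stage-A literal `JsBalW2Of hLc cE cVH cΛ hT₂ hmix`, the
bi-stencil tables `T₂` a BINDER) at an2's RECURSIVE tables — `BalabanStepW2.JsBalT2Of hLc cE cVH cΛ cE₂ cB T hB hmix := JsBalW2Of hLc cE cVH
cΛ (T2Of_loc hLc cE cVH cΛ cE₂ cB T hB hmix) hmix` (`JsBalT2Of_eq` = `rfl`; `T2Of 0 = cE₂•wilsonW₂ T + cB•(mfNeg ∘ vh₂S)`, `T2Of (j+1) =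
(cE₂·wV4 (j+1))•e4OfW j (Spure j) (M1 j) (WbalOf … (T2Of …) … j) + (cB·wB2 (j+1))•(mfNeg ∘ vh₂S)`) — and asserts nothing printed by
Bałaban.  EVERY load-bearing β-binder below (`D1Drift`, the six (CONV-C-Cauchy) data binders, `hident`, `AllScalesSeq`, the certified list,
`RemainderConst`, `BetaContH`) is a HYPOTHESIS; for the literal `JsBalT2Of …` the binder `hD : D1Drift Lc (JsBalT2Of …) N μ ν` IS THE WALL
(EXIT-A of the cell) — nothing here proves it, and nothing here could: the wall is UNTOUCHED; road-(1) verdict unchanged (PRECISELY WALLED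
at END-STATEMENT grade; nothing of (M2⁺)/`BetaPertH` discharged); value = census precision (MISSING-B14 §9 Table 9.1: the `hD` column of
the [III] carrier is a closed term of the tree modulo the binders that REMAIN after Stage B — an3's Wilson two-bond position table `T` (by
value), an1's second-order averaging border `vh₂S` with `hB : ∃ C δ, 0 < δ ∧ LocStencil₂ vh₂S C δ` (node 12b), the mixed table `mixFF` with
`hmix`, the colour / sign constants `cE cVH cΛ cE₂ cB` (P6), and — inside `Sstep`/`Spure`/`M1`/`M2Of`/`wV4`/`wB2`, BY NAME, invisible to
every lemma — the PROVISIONAL UNITS numerals (P6′)), NOT summit progress.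

ABSOLUTE RULE (cell charter, verbatim): "No internally-minted statement may enter as a cited fact. Every hypothesis is either
kernel-proved in this package or a verbatim quotation of a PUBLISHED theorem with page reference. The manuscript(s) under audit are
NOT citable for their own disputed steps — they are the thing under adjudication; programme-internal (2001/route/tribunal) claims
are never citable."

WHAT IS HERE (one-application theorems; `AveragedAFCarrierJsBalW2` §1–§4 at `hT₂ := T2Of_loc hLc cE cVH cΛ cE₂ cB T hB hmix`, the
literal accepted in the `hβ`/`hD`/`hall` slots by `JsBalT2Of_eq`-defeq):
* §1 (D1) CURRENCY: `wallEND_of_D1Drift_JsBalT2Of_cont_allProfiles` — binders = the literal's own (`hLc`, `cE cVH cΛ cE₂ cB`, `T`,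
  implicit `vh₂S`/`mixFF` through `hB`/`hmix`) + `ForwardGenerated`, the split `S` with `hβ`, **`hD : D1Drift Lc (JsBalT2Of …) N μ ν`**,
  (D4) `RemainderConst S γ₀ r` with `r < stepBal N Lc` STRICTLY, (C) `BetaContH γ₀ β`, `0 < γ₀`, run-side ⟹ `EndpointExistence Cn ∧ ∃ A,
  ∃ γ₁ > 0, …, sizes ∧ HorizonFacts`, `β′ := stepBal N Lc + 2A + r`; `flowIneq_…` ((2.6)–(2.9) alone, `r ≤`, NO (C)); `t4FlowInputs_…`;
  `betaAvgAFH_…`.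
* §2 THE STAGE-B LITERAL WRITTEN OUT: `secondMoment_TbalOf_JsBalT2Of`, `d1Drift_JsBalT2Of_iff` (an2's `TbalOf_JsBalT2Of` BY NAME: the
  RECURSIVE family `WbalT2Of … j` in the table slot), closed-form END.
* §3 CAUCHY / LIMIT CURRENCY: `wallEND_of_cauchy_eq_JsBalT2Of_cont_allProfiles` + carrier — the six (CONV-C-Cauchy) rows with the table
  rows on `WbalOf 3 Lc cE cVH cΛ (T2Of …) mixFF j` (the `j`-UNIFORM row STAYS a binder: `T2Of_loc`/`WbalOf_loc₂` are per-`j` existential)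
  + `hident` at the constructed limits with `W∞ := limTabOf (WbalOf 3 Lc cE cVH cΛ (T2Of …) mixFF)`.
* §4 ROAD B: `allScalesConst_END_JsBalT2Of_allProfiles_cont` + carrier (defect 0; NO identification).
The named-limit form, the census form (P5′ · `hbase` · (SDF) · `D1Rep`) and every other currency form of the three JsBal leaves apply to
the Stage-B literal BY NAME in the same way; they are not re-typed here (400-line cell-tree cap).

NON-VACUITY.  Abstract lists inhabited (lead `Beta.WallWitness`, `StepDriftWitness`, `AveragedAFCarrierAllScales` §5); for the literal the
inhabitation of `hD` / `hident` / the (CONV-C-Cauchy) rows / `hall`'s suppliers IS the open wall and the sub-cell's open supplier rows —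
no witness offered or possible, by design; the theorems are implications.  READING CLAUSE (W-KKT-2) as in the JsBal leaves: the
identification of the `μ ≠ ν` second moment of `TbalOf Lc (JsBalT2Of …) j` with Bałaban's printed (1.22) coefficient is the sub-cell's
READING, delivered with (T-def) — NOT asserted by any theorem here.
-/

noncomputable section

namespace Summit.QuantumFields.BalabanUV.Beta.AveragedAFCarrierJsBalT2

open Finset
open Literature.MathematicalPhysics.QuantumFieldTheory.Balaban1983to89
open Literature.MathematicalPhysics.QuantumFieldTheory.Balaban1983to89.Beta
open FlowStep FlowStepRuns DagBinding B14DeltaBeta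
open Literature.MathematicalPhysics.QuantumFieldTheory.Balaban1983to89.Beta.Drift (OneLoopDrift)
open Literature.MathematicalPhysics.QuantumFieldTheory.Balaban1983to89.Beta.RemainderChain (RemainderConst)
open Literature.MathematicalPhysics.QuantumFieldTheory.Balaban1983to89.Beta.RemainderConstAllScales (AllScalesSeq)
open Literature.MathematicalPhysics.QuantumFieldTheory.Balaban1983to89.Beta.OneStepResolventKernel (Fib LocStencil JetData)
open Literature.MathematicalPhysics.QuantumFieldTheory.Balaban1983to89.Beta.OneStepKernelFamily (KInvStep TbalOf D1Drift)
open Literature.MathematicalPhysics.QuantumFieldTheory.Balaban1983to89.Beta.AxialDressing (axDressK axVertexOfK)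
open Literature.MathematicalPhysics.QuantumFieldTheory.Balaban1983to89.Beta.BalabanStepJetsSucc (JsBal0Of JsBalOf)
open Literature.MathematicalPhysics.QuantumFieldTheory.Balaban1983to89.Beta.BalabanCompositeJets (LocStencil₂)
open Literature.MathematicalPhysics.QuantumFieldTheory.Balaban1983to89.Beta.SecondOrderResponse (LocStencilFM)
open Literature.MathematicalPhysics.QuantumFieldTheory.Balaban1983to89.Beta.BalabanStepW2
  (WbalOf CwOf δwOf δwOf_pos WbalOf_loc₂ JsBalW2Of T2Of T2Of_loc WbalT2Of JsBalT2Of TbalOf_JsBalT2Of)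
open Literature.MathematicalPhysics.QuantumFieldTheory.Balaban1983to89.B12Beta (secondMoment)
open ExpKernelCalculus (MKer Decays VertexFamily₂ hessKer)
open Literature.MathematicalPhysics.QuantumFieldTheory.Balaban1983to89.Beta.HessKerDressedLimit (limMKerOf limStOf limTabOf)
open Literature.MathematicalPhysics.QuantumFieldTheory.Balaban1983to89.Beta.AveragedAFCarrier (BetaAvgAFH)
open Literature.MathematicalPhysics.QuantumFieldTheory.Balaban1983to89.Beta.AveragedAFCarrierJsBalW2

variable {β : HBeta} {Lc : ℕ} [NeZero Lc] {Λ : Type*}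
  (hLc : 1 ≤ Lc) (cE cVH cΛ cE₂ cB : ℝ) (T : Fin 4 → Fin 4 → Fin 4 → Fin 4 → ℝ)
  {vh₂S : Fin (3 + 1) → (Fin (3 + 1) → ℤ) → Fin (3 + 1) → (Fin (3 + 1) → ℤ) → MKer (3 + 1) (Fib 3)}
  (hB : ∃ C δ : ℝ, 0 < δ ∧ LocStencil₂ vh₂S C δ)
  {mixFF : Fin (3 + 1) → (Fin (3 + 1) → ℤ) → Fin (3 + 1) → (Fin (3 + 1) → ℤ) → MKer (3 + 1) (Fib 3)}
  (hmix : ∃ C δ : ℝ, 0 < δ ∧ LocStencilFM Lc mixFF C δ)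

/-! ## §1 (D1) currency: the wall's Stage-B literal `D1Drift Lc (JsBalT2Of …) N μ ν` ⟹ the whole located [III] list -/

section StatementForm

/-- **THE WHOLE LOCATED [III] LIST OVER THE WALL'S STAGE-B LITERAL, ALL PROFILES** — `AveragedAFCarrierJsBalW2.wallEND_of_D1Drift_JsBalW2Of_cont_allProfiles`
at `hT₂ := T2Of_loc hLc cE cVH cΛ cE₂ cB T hB hmix` (an2 `JsBalT2Of_eq`, `rfl`): binders = the literal's own (`hLc`, `cE cVH cΛ cE₂ cB`, `T`,
`hB`, `hmix`) + `ForwardGenerated`, the split `S` with `hβ`, **THE WALL `hD : D1Drift Lc (JsBalT2Of …) N μ ν`**, **(D4) STRICT**, **(C)**,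
`0 < γ₀`, run-side ⟹ `EndpointExistence Cn ∧ ∃ A, ∃ γ₁ > 0, …, sizes ∧ HorizonFacts` with `β′ := stepBal N Lc + 2A + r`.  Discharges nothing of
`BetaPertH` (`hD` is the wall).  Our own derived statement; consumes [Balaban1987RG1] Thm 2/3, [Balaban1988Convergent] (2.5)–(2.9), (2.46)
through the imported carriers. -/
theorem wallEND_of_D1Drift_JsBalT2Of_cont_allProfiles {Cn : B12.Construction} (hgen : ForwardGenerated Cn β)
    (hhalt : HaltsOutside Cn β) (hcur : CurriesHBeta Cn β) (S : B12Beta.OneLoopSplit β) {N : ℝ} {μ ν : Fin 4}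
    (hβ : ∀ j, S.β0 j = secondMoment (TbalOf Lc (JsBalT2Of hLc cE cVH cΛ cE₂ cB T hB hmix) j) μ ν)
    (hD : D1Drift Lc (JsBalT2Of hLc cE cVH cΛ cE₂ cB T hB hmix) N μ ν) {γ₀ r β₀ : ℝ}
    (hγ₀ : 0 < γ₀) (hrem : RemainderConst S γ₀ r) (hr : r < B12Normalization.stepBal N Lc) (hcont : BetaContH γ₀ β)
    (hβ₀ : 0 < β₀) {L : ℕ} (hL2 : 2 ≤ L) (p : ℕ) {κ₀ : ℕ} (hκ : 6 ≤ κ₀) :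
    EndpointExistence Cn ∧ ∃ A : ℝ, ∃ γ₁ : ℝ, 0 < γ₁ ∧
      ∀ γ : ℝ, 0 < γ → γ ≤ min γ₀ γ₁ → ∀ Pr : B12.RunParams, (Cn Pr).flow.InInterval γ Pr.K →
        ∀ p' : ℕ, p' ≤ p → ∀ A₀ : ℝ, 0 ≤ A₀ →
          ∃ Rj : ℕ → ℕ, (∀ j, B14.IsRj L p' ((Cn Pr).flow.g j) (Rj j)) ∧
            HorizonFacts (Cn Pr).flow (B12Normalization.stepBal N Lc + 2 * A + r) β₀ A₀ L p' κ₀ Rj Pr.K :=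
  wallEND_of_D1Drift_JsBalW2Of_cont_allProfiles hLc cE cVH cΛ (T2Of_loc hLc cE cVH cΛ cE₂ cB T hB hmix) hmix hgen hhalt hcur S
    hβ hD hγ₀ hrem hr hcont hβ₀ hL2 p hκ

/-- **… AT `r ≤ stepBal N Lc`, NO (C): (2.6)–(2.9) FOR ALL PROFILES** over the Stage-B literal
(`AveragedAFCarrierJsBalW2.flowIneq_of_D1Drift_JsBalW2Of_allProfiles` at `hT₂ := T2Of_loc …`).  Our own derived statement. -/
theorem flowIneq_of_D1Drift_JsBalT2Of_allProfiles {Cn : B12.Construction} (hgen : ForwardGenerated Cn β)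
    (hhalt : HaltsOutside Cn β) (hcur : CurriesHBeta Cn β) (S : B12Beta.OneLoopSplit β) {N : ℝ} {μ ν : Fin 4}
    (hβ : ∀ j, S.β0 j = secondMoment (TbalOf Lc (JsBalT2Of hLc cE cVH cΛ cE₂ cB T hB hmix) j) μ ν)
    (hD : D1Drift Lc (JsBalT2Of hLc cE cVH cΛ cE₂ cB T hB hmix) N μ ν) {γ₀ r β₀ : ℝ}
    (hγ₀ : 0 < γ₀) (hrem : RemainderConst S γ₀ r) (hr : r ≤ B12Normalization.stepBal N Lc) (hβ₀ : 0 < β₀) {L : ℕ}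
    (hL2 : 2 ≤ L) (p : ℕ) :
    ∃ A : ℝ, ∃ γ₁ : ℝ, 0 < γ₁ ∧
      ∀ γ : ℝ, 0 < γ → γ ≤ min γ₀ γ₁ → ∀ Pr : B12.RunParams, (Cn Pr).flow.InInterval γ Pr.K →
        ∀ p' : ℕ, p' ≤ p → ∀ A₀ : ℝ, 0 ≤ A₀ →
          ∃ Rj : ℕ → ℕ, (∀ j, B14.IsRj L p' ((Cn Pr).flow.g j) (Rj j)) ∧
            B14.FlowIneq26 (Cn Pr).flow.g (B12Normalization.stepBal N Lc + 2 * A + r) β₀ Pr.K ∧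
            B14.FlowIneq27 (Cn Pr).flow.g (B12Normalization.stepBal N Lc + 2 * A + r) β₀ p' Pr.K ∧
            B14.FlowIneq28 (epsK A₀ p' (Cn Pr).flow) (Cn Pr).flow.g (B12Normalization.stepBal N Lc + 2 * A + r) β₀ Pr.K ∧
            B14FlowStep.FlowIneq29 Rj (Cn Pr).flow.g L (B12Normalization.stepBal N Lc + 2 * A + r) β₀ Pr.K :=
  flowIneq_of_D1Drift_JsBalW2Of_allProfiles hLc cE cVH cΛ (T2Of_loc hLc cE cVH cΛ cE₂ cB T hB hmix) hmix hgen hhalt hcur S hβ hD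
    hγ₀ hrem hr hβ₀ hL2 p

/-- **… AT `r ≤ stepBal N Lc`, NO (C): THE T⁴ CELL's FLOW-FACT BINDERS (MISSING-B14 §8 C19/C20) over the Stage-B literal**
(`AveragedAFCarrierJsBalW2.t4FlowInputs_of_D1Drift_JsBalW2Of` at `hT₂ := T2Of_loc …`).  Our own derived statement. -/
theorem t4FlowInputs_of_D1Drift_JsBalT2Of {Cn : B12.Construction} (hgen : ForwardGenerated Cn β)
    (hhalt : HaltsOutside Cn β) (hcur : CurriesHBeta Cn β) (S : B12Beta.OneLoopSplit β) {N : ℝ} {μ ν : Fin 4}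
    (hβ : ∀ j, S.β0 j = secondMoment (TbalOf Lc (JsBalT2Of hLc cE cVH cΛ cE₂ cB T hB hmix) j) μ ν)
    (hD : D1Drift Lc (JsBalT2Of hLc cE cVH cΛ cE₂ cB T hB hmix) N μ ν) {γ₀ r β₀ : ℝ}
    (hγ₀ : 0 < γ₀) (hrem : RemainderConst S γ₀ r) (hr : r ≤ B12Normalization.stepBal N Lc) (hβ₀ : 0 < β₀) {L : ℕ}
    (hL2 : 2 ≤ L) {p₀ r' : ℕ} (hr' : r' ≤ p₀) :
    ∃ A : ℝ, ∃ γ₁ : ℝ, 0 < γ₁ ∧ ∀ γ : ℝ, 0 < γ → γ ≤ min γ₀ γ₁ → ∀ Pr : B12.RunParams, (Cn Pr).flow.InInterval γ Pr.K →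
      B14.FlowIneq27 (Cn Pr).flow.g (B12Normalization.stepBal N Lc + 2 * A + r) β₀ p₀ Pr.K ∧
      (∀ j, j ≤ Pr.K → 1 ≤ Real.log (((Cn Pr).flow.g j) ^ 2)⁻¹) ∧
      ∃ Rj : ℕ → ℕ, (∀ j, B14.IsRj L r' ((Cn Pr).flow.g j) (Rj j)) ∧
        B14FlowStep.FlowIneq29 Rj (Cn Pr).flow.g L (B12Normalization.stepBal N Lc + 2 * A + r) β₀ Pr.K :=
  t4FlowInputs_of_D1Drift_JsBalW2Of hLc cE cVH cΛ (T2Of_loc hLc cE cVH cΛ cE₂ cB T hB hmix) hmix hgen hhalt hcur S hβ hD hγ₀ hrem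
    hr hβ₀ hL2 hr'

/-- **THE MINIMAL [III] CARRIER OVER THE STAGE-B LITERAL**: the wall + `hβ` + (D4) ⟹ `∃ A, BetaAvgAFH (stepBal N Lc − r) (2A) γ β`
(`AveragedAFCarrierJsBalW2.betaAvgAFH_of_D1Drift_JsBalW2Of` at `hT₂ := T2Of_loc …`).  Our own derived statement. -/
theorem betaAvgAFH_of_D1Drift_JsBalT2Of (S : B12Beta.OneLoopSplit β) {N : ℝ} {μ ν : Fin 4}
    (hβ : ∀ j, S.β0 j = secondMoment (TbalOf Lc (JsBalT2Of hLc cE cVH cΛ cE₂ cB T hB hmix) j) μ ν)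
    (hD : D1Drift Lc (JsBalT2Of hLc cE cVH cΛ cE₂ cB T hB hmix) N μ ν) {γ r : ℝ} (hrem : RemainderConst S γ r) :
    ∃ A : ℝ, BetaAvgAFH (B12Normalization.stepBal N Lc - r) (2 * A) γ β :=
  betaAvgAFH_of_D1Drift_JsBalW2Of hLc cE cVH cΛ (T2Of_loc hLc cE cVH cΛ cE₂ cB T hB hmix) hmix S hβ hD hrem

end StatementForm

/-! ## §2 The Stage-B literal written out: the RECURSIVE second-order family `WbalT2Of … j` in the table slot (`TbalOf_JsBalT2Of`) -/

section ClosedForm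

/-- **THE LITERAL'S ONE-LOOP NUMBERS, MEMBER BY MEMBER, IN CLOSED `Π`-FORM** — an2's `TbalOf_JsBalT2Of` under `secondMoment`: the table slot
carries `WbalT2Of … j = W2SymOfK (KInvStep Lc j) Lc (Spure j) (M1 j) (T2Of … j) (M2Of mixFF j)`.  A standard unfolding lemma. -/
theorem secondMoment_TbalOf_JsBalT2Of (j : ℕ) (μ ν : Fin 4) :
    secondMoment (TbalOf Lc (JsBalT2Of hLc cE cVH cΛ cE₂ cB T hB hmix) j) μ ν
      = secondMoment (hessKer (axDressK Lc (KInvStep (d := 3) Lc j))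
          (axVertexOfK (KInvStep (d := 3) Lc j) Lc
            (JsBal0Of hLc cE cVH cΛ (WbalT2Of (Lc := Lc) cE cVH cΛ cE₂ cB T (vh₂S := vh₂S) (mixFF := mixFF))
              (CwOf hLc cE cVH cΛ (T2Of_loc hLc cE cVH cΛ cE₂ cB T hB hmix) hmix)
              (δwOf hLc cE cVH cΛ (T2Of_loc hLc cE cVH cΛ cE₂ cB T hB hmix) hmix)
              (δwOf_pos hLc cE cVH cΛ (T2Of_loc hLc cE cVH cΛ cE₂ cB T hB hmix) hmix)
              (WbalOf_loc₂ hLc cE cVH cΛ (T2Of_loc hLc cE cVH cΛ cE₂ cB T hB hmix) hmix) j).S)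
          (WbalT2Of (Lc := Lc) cE cVH cΛ cE₂ cB T (vh₂S := vh₂S) (mixFF := mixFF) j)) μ ν := by
  rw [TbalOf_JsBalT2Of]

/-- **THE WALL STATEMENT AFTER STAGE B, WRITTEN OUT** (unfolded once through `D1Drift` and `TbalOf_JsBalT2Of`): `D1Drift Lc (JsBalT2Of …) N μ ν`
IS `∃ A, ∀ k, |Σ_{j<k} secondMoment (hessKer (axDressK Lc (KInvStep Lc j)) (axVertexOfK (KInvStep Lc j) Lc (JsBal⁰_j).S) (WbalT2Of … j)) μ ν
− stepBal N Lc · k| ≤ A` — the RECURSIVE second-order family in the table slot.  A restatement of the hypothesis; a standard unfolding lemma. -/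
theorem d1Drift_JsBalT2Of_iff {N : ℝ} {μ ν : Fin 4} :
    D1Drift Lc (JsBalT2Of hLc cE cVH cΛ cE₂ cB T hB hmix) N μ ν ↔
      ∃ A : ℝ, ∀ k : ℕ,
        |∑ j ∈ Finset.range k,
            secondMoment (hessKer (axDressK Lc (KInvStep (d := 3) Lc j))
              (axVertexOfK (KInvStep (d := 3) Lc j) Lc
                (JsBal0Of hLc cE cVH cΛ (WbalT2Of (Lc := Lc) cE cVH cΛ cE₂ cB T (vh₂S := vh₂S) (mixFF := mixFF))
                  (CwOf hLc cE cVH cΛ (T2Of_loc hLc cE cVH cΛ cE₂ cB T hB hmix) hmix)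
                  (δwOf hLc cE cVH cΛ (T2Of_loc hLc cE cVH cΛ cE₂ cB T hB hmix) hmix)
                  (δwOf_pos hLc cE cVH cΛ (T2Of_loc hLc cE cVH cΛ cE₂ cB T hB hmix) hmix)
                  (WbalOf_loc₂ hLc cE cVH cΛ (T2Of_loc hLc cE cVH cΛ cE₂ cB T hB hmix) hmix) j).S)
              (WbalT2Of (Lc := Lc) cE cVH cΛ cE₂ cB T (vh₂S := vh₂S) (mixFF := mixFF) j)) μ ν
          - B12Normalization.stepBal N Lc * k| ≤ A := by
  have h : (fun j => secondMoment (TbalOf Lc (JsBalT2Of hLc cE cVH cΛ cE₂ cB T hB hmix) j) μ ν)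
      = fun j => secondMoment (hessKer (axDressK Lc (KInvStep (d := 3) Lc j))
          (axVertexOfK (KInvStep (d := 3) Lc j) Lc
            (JsBal0Of hLc cE cVH cΛ (WbalT2Of (Lc := Lc) cE cVH cΛ cE₂ cB T (vh₂S := vh₂S) (mixFF := mixFF))
              (CwOf hLc cE cVH cΛ (T2Of_loc hLc cE cVH cΛ cE₂ cB T hB hmix) hmix)
              (δwOf hLc cE cVH cΛ (T2Of_loc hLc cE cVH cΛ cE₂ cB T hB hmix) hmix)
              (δwOf_pos hLc cE cVH cΛ (T2Of_loc hLc cE cVH cΛ cE₂ cB T hB hmix) hmix)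
              (WbalOf_loc₂ hLc cE cVH cΛ (T2Of_loc hLc cE cVH cΛ cE₂ cB T hB hmix) hmix) j).S)
          (WbalT2Of (Lc := Lc) cE cVH cΛ cE₂ cB T (vh₂S := vh₂S) (mixFF := mixFF) j)) μ ν := by
    funext j; rw [TbalOf_JsBalT2Of]
  unfold D1Drift OneLoopDrift
  rw [h]

end ClosedForm

/-! ## §3 Cauchy / limit currency over the Stage-B literal (`AveragedAFCarrierJsBalW2` §3 at `hT₂ := T2Of_loc …`) -/

section LimitCurrency

variable {R C cK δK Cs cS δS C₂ c₂ δ₂ θ : ℝ}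

/-- **THE WHOLE LOCATED [III] LIST OVER THE STAGE-B LITERAL FROM (CONV-C-Cauchy) + THE EXPLICIT IDENTIFICATION AT THE CONSTRUCTED LIMITS,
ALL PROFILES** — `AveragedAFCarrierJsBalW2.wallEND_of_cauchy_eq_JsBalW2Of_cont_allProfiles` at `hT₂ := T2Of_loc …`: EXACTLY the six
(CONV-C-Cauchy) data binders, the table rows on `WbalOf 3 Lc cE cVH cΛ (T2Of …) mixFF j` (the `j`-UNIFORM row STAYS a binder) and the
all-scales deviations; `0 < R < δK`, `R/2 < δS`, `R < δ₂`; `0 ≤ θ < 1`; + `hident` at `(limMKerOf (KInvStep Lc), limStOf (j ↦ (JsBal⁰_j).S),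
limTabOf (WbalOf 3 Lc cE cVH cΛ (T2Of …) mixFF))`; then §1.  Discharges nothing of `BetaPertH` (`hident` is the wall, read explicitly; the
six rows are located-unprinted hypothesis shapes).  Our own derived statement. -/
theorem wallEND_of_cauchy_eq_JsBalT2Of_cont_allProfiles
    (hK : ∀ j, Decays (KInvStep (d := 3) Lc j) C δK)
    (hKall : ∀ k j, Decays (KInvStep (d := 3) Lc (k + j) - KInvStep (d := 3) Lc k) (cK * θ ^ k) δK)
    (hS : ∀ j, LocStencil (JsBal0Of hLc cE cVH cΛ (WbalOf 3 Lc cE cVH cΛ (T2Of 3 Lc cE cVH cΛ cE₂ cB T vh₂S mixFF) mixFF)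
      (CwOf hLc cE cVH cΛ (T2Of_loc hLc cE cVH cΛ cE₂ cB T hB hmix) hmix) (δwOf hLc cE cVH cΛ (T2Of_loc hLc cE cVH cΛ cE₂ cB T hB hmix) hmix)
      (δwOf_pos hLc cE cVH cΛ (T2Of_loc hLc cE cVH cΛ cE₂ cB T hB hmix) hmix)
      (WbalOf_loc₂ hLc cE cVH cΛ (T2Of_loc hLc cE cVH cΛ cE₂ cB T hB hmix) hmix) j).S Cs δS)
    (hSall : ∀ k j, LocStencil
      ((JsBal0Of hLc cE cVH cΛ (WbalOf 3 Lc cE cVH cΛ (T2Of 3 Lc cE cVH cΛ cE₂ cB T vh₂S mixFF) mixFF)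
          (CwOf hLc cE cVH cΛ (T2Of_loc hLc cE cVH cΛ cE₂ cB T hB hmix) hmix) (δwOf hLc cE cVH cΛ (T2Of_loc hLc cE cVH cΛ cE₂ cB T hB hmix) hmix)
          (δwOf_pos hLc cE cVH cΛ (T2Of_loc hLc cE cVH cΛ cE₂ cB T hB hmix) hmix)
          (WbalOf_loc₂ hLc cE cVH cΛ (T2Of_loc hLc cE cVH cΛ cE₂ cB T hB hmix) hmix) (k + j)).S
        - (JsBal0Of hLc cE cVH cΛ (WbalOf 3 Lc cE cVH cΛ (T2Of 3 Lc cE cVH cΛ cE₂ cB T vh₂S mixFF) mixFF)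
          (CwOf hLc cE cVH cΛ (T2Of_loc hLc cE cVH cΛ cE₂ cB T hB hmix) hmix) (δwOf hLc cE cVH cΛ (T2Of_loc hLc cE cVH cΛ cE₂ cB T hB hmix) hmix)
          (δwOf_pos hLc cE cVH cΛ (T2Of_loc hLc cE cVH cΛ cE₂ cB T hB hmix) hmix)
          (WbalOf_loc₂ hLc cE cVH cΛ (T2Of_loc hLc cE cVH cΛ cE₂ cB T hB hmix) hmix) k).S) (cS * θ ^ k) δS)
    (hW₂ : ∀ j, VertexFamily₂ (WbalOf 3 Lc cE cVH cΛ (T2Of 3 Lc cE cVH cΛ cE₂ cB T vh₂S mixFF) mixFF j) Lc C₂ δ₂)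
    (hW₂all : ∀ k j, VertexFamily₂ (WbalOf 3 Lc cE cVH cΛ (T2Of 3 Lc cE cVH cΛ cE₂ cB T vh₂S mixFF) mixFF (k + j)
      - WbalOf 3 Lc cE cVH cΛ (T2Of 3 Lc cE cVH cΛ cE₂ cB T vh₂S mixFF) mixFF k) Lc (c₂ * θ ^ k) δ₂)
    (hR : 0 < R) (hRK : R < δK) (hRS : R / 2 < δS) (hRW : R < δ₂) (hθ0 : 0 ≤ θ) (hθ1 : θ < 1) {μ ν : Fin 4} {N : ℝ}
    (hident : secondMoment (hessKer (axDressK Lc (limMKerOf (KInvStep (d := 3) Lc)))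
        (axVertexOfK (limMKerOf (KInvStep (d := 3) Lc)) Lc (limStOf fun j =>
          (JsBal0Of hLc cE cVH cΛ (WbalOf 3 Lc cE cVH cΛ (T2Of 3 Lc cE cVH cΛ cE₂ cB T vh₂S mixFF) mixFF)
            (CwOf hLc cE cVH cΛ (T2Of_loc hLc cE cVH cΛ cE₂ cB T hB hmix) hmix)
            (δwOf hLc cE cVH cΛ (T2Of_loc hLc cE cVH cΛ cE₂ cB T hB hmix) hmix)
            (δwOf_pos hLc cE cVH cΛ (T2Of_loc hLc cE cVH cΛ cE₂ cB T hB hmix) hmix)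
            (WbalOf_loc₂ hLc cE cVH cΛ (T2Of_loc hLc cE cVH cΛ cE₂ cB T hB hmix) hmix) j).S))
        (limTabOf (WbalOf 3 Lc cE cVH cΛ (T2Of 3 Lc cE cVH cΛ cE₂ cB T vh₂S mixFF) mixFF))) μ ν = B12Normalization.stepBal N Lc)
    {Cn : B12.Construction} (hgen : ForwardGenerated Cn β) (hhalt : HaltsOutside Cn β) (hcur : CurriesHBeta Cn β)
    (S : B12Beta.OneLoopSplit β)
    (hβ : ∀ j, S.β0 j = secondMoment (TbalOf Lc (JsBalT2Of hLc cE cVH cΛ cE₂ cB T hB hmix) j) μ ν) {γ₀ r β₀ : ℝ}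
    (hγ₀ : 0 < γ₀) (hrem : RemainderConst S γ₀ r) (hr : r < B12Normalization.stepBal N Lc) (hcont : BetaContH γ₀ β)
    (hβ₀ : 0 < β₀) {L : ℕ} (hL2 : 2 ≤ L) (p : ℕ) {κ₀ : ℕ} (hκ : 6 ≤ κ₀) :
    EndpointExistence Cn ∧ ∃ A : ℝ, ∃ γ₁ : ℝ, 0 < γ₁ ∧
      ∀ γ : ℝ, 0 < γ → γ ≤ min γ₀ γ₁ → ∀ Pr : B12.RunParams, (Cn Pr).flow.InInterval γ Pr.K →
        ∀ p' : ℕ, p' ≤ p → ∀ A₀ : ℝ, 0 ≤ A₀ →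
          ∃ Rj : ℕ → ℕ, (∀ j, B14.IsRj L p' ((Cn Pr).flow.g j) (Rj j)) ∧
            HorizonFacts (Cn Pr).flow (B12Normalization.stepBal N Lc + 2 * A + r) β₀ A₀ L p' κ₀ Rj Pr.K :=
  wallEND_of_cauchy_eq_JsBalW2Of_cont_allProfiles hLc cE cVH cΛ (T2Of_loc hLc cE cVH cΛ cE₂ cB T hB hmix) hmix hK hKall hS hSall
    hW₂ hW₂all hR hRK hRS hRW hθ0 hθ1 hident hgen hhalt hcur S hβ hγ₀ hrem hr hcont hβ₀ hL2 p hκ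

/-- **THE MINIMAL [III] CARRIER OVER THE STAGE-B LITERAL FROM (CONV-C-Cauchy) + THE EXPLICIT IDENTIFICATION AT THE CONSTRUCTED LIMITS**:
`∃ A, BetaAvgAFH (stepBal N Lc − r) (2A) γ β` (`AveragedAFCarrierJsBalW2.betaAvgAFH_of_cauchy_eq_JsBalW2Of` at `hT₂ := T2Of_loc …`).  Our
own derived statement. -/
theorem betaAvgAFH_of_cauchy_eq_JsBalT2Of
    (hK : ∀ j, Decays (KInvStep (d := 3) Lc j) C δK)
    (hKall : ∀ k j, Decays (KInvStep (d := 3) Lc (k + j) - KInvStep (d := 3) Lc k) (cK * θ ^ k) δK)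
    (hS : ∀ j, LocStencil (JsBal0Of hLc cE cVH cΛ (WbalOf 3 Lc cE cVH cΛ (T2Of 3 Lc cE cVH cΛ cE₂ cB T vh₂S mixFF) mixFF)
      (CwOf hLc cE cVH cΛ (T2Of_loc hLc cE cVH cΛ cE₂ cB T hB hmix) hmix) (δwOf hLc cE cVH cΛ (T2Of_loc hLc cE cVH cΛ cE₂ cB T hB hmix) hmix)
      (δwOf_pos hLc cE cVH cΛ (T2Of_loc hLc cE cVH cΛ cE₂ cB T hB hmix) hmix)
      (WbalOf_loc₂ hLc cE cVH cΛ (T2Of_loc hLc cE cVH cΛ cE₂ cB T hB hmix) hmix) j).S Cs δS)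
    (hSall : ∀ k j, LocStencil
      ((JsBal0Of hLc cE cVH cΛ (WbalOf 3 Lc cE cVH cΛ (T2Of 3 Lc cE cVH cΛ cE₂ cB T vh₂S mixFF) mixFF)
          (CwOf hLc cE cVH cΛ (T2Of_loc hLc cE cVH cΛ cE₂ cB T hB hmix) hmix) (δwOf hLc cE cVH cΛ (T2Of_loc hLc cE cVH cΛ cE₂ cB T hB hmix) hmix)
          (δwOf_pos hLc cE cVH cΛ (T2Of_loc hLc cE cVH cΛ cE₂ cB T hB hmix) hmix)
          (WbalOf_loc₂ hLc cE cVH cΛ (T2Of_loc hLc cE cVH cΛ cE₂ cB T hB hmix) hmix) (k + j)).S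
        - (JsBal0Of hLc cE cVH cΛ (WbalOf 3 Lc cE cVH cΛ (T2Of 3 Lc cE cVH cΛ cE₂ cB T vh₂S mixFF) mixFF)
          (CwOf hLc cE cVH cΛ (T2Of_loc hLc cE cVH cΛ cE₂ cB T hB hmix) hmix) (δwOf hLc cE cVH cΛ (T2Of_loc hLc cE cVH cΛ cE₂ cB T hB hmix) hmix)
          (δwOf_pos hLc cE cVH cΛ (T2Of_loc hLc cE cVH cΛ cE₂ cB T hB hmix) hmix)
          (WbalOf_loc₂ hLc cE cVH cΛ (T2Of_loc hLc cE cVH cΛ cE₂ cB T hB hmix) hmix) k).S) (cS * θ ^ k) δS)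
    (hW₂ : ∀ j, VertexFamily₂ (WbalOf 3 Lc cE cVH cΛ (T2Of 3 Lc cE cVH cΛ cE₂ cB T vh₂S mixFF) mixFF j) Lc C₂ δ₂)
    (hW₂all : ∀ k j, VertexFamily₂ (WbalOf 3 Lc cE cVH cΛ (T2Of 3 Lc cE cVH cΛ cE₂ cB T vh₂S mixFF) mixFF (k + j)
      - WbalOf 3 Lc cE cVH cΛ (T2Of 3 Lc cE cVH cΛ cE₂ cB T vh₂S mixFF) mixFF k) Lc (c₂ * θ ^ k) δ₂)
    (hR : 0 < R) (hRK : R < δK) (hRS : R / 2 < δS) (hRW : R < δ₂) (hθ0 : 0 ≤ θ) (hθ1 : θ < 1) {μ ν : Fin 4} {N : ℝ}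
    (hident : secondMoment (hessKer (axDressK Lc (limMKerOf (KInvStep (d := 3) Lc)))
        (axVertexOfK (limMKerOf (KInvStep (d := 3) Lc)) Lc (limStOf fun j =>
          (JsBal0Of hLc cE cVH cΛ (WbalOf 3 Lc cE cVH cΛ (T2Of 3 Lc cE cVH cΛ cE₂ cB T vh₂S mixFF) mixFF)
            (CwOf hLc cE cVH cΛ (T2Of_loc hLc cE cVH cΛ cE₂ cB T hB hmix) hmix)
            (δwOf hLc cE cVH cΛ (T2Of_loc hLc cE cVH cΛ cE₂ cB T hB hmix) hmix)
            (δwOf_pos hLc cE cVH cΛ (T2Of_loc hLc cE cVH cΛ cE₂ cB T hB hmix) hmix)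
            (WbalOf_loc₂ hLc cE cVH cΛ (T2Of_loc hLc cE cVH cΛ cE₂ cB T hB hmix) hmix) j).S))
        (limTabOf (WbalOf 3 Lc cE cVH cΛ (T2Of 3 Lc cE cVH cΛ cE₂ cB T vh₂S mixFF) mixFF))) μ ν = B12Normalization.stepBal N Lc)
    (S : B12Beta.OneLoopSplit β)
    (hβ : ∀ j, S.β0 j = secondMoment (TbalOf Lc (JsBalT2Of hLc cE cVH cΛ cE₂ cB T hB hmix) j) μ ν) {γ r : ℝ}
    (hrem : RemainderConst S γ r) :
    ∃ A : ℝ, BetaAvgAFH (B12Normalization.stepBal N Lc - r) (2 * A) γ β :=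
  betaAvgAFH_of_cauchy_eq_JsBalW2Of hLc cE cVH cΛ (T2Of_loc hLc cE cVH cΛ cE₂ cB T hB hmix) hmix hK hKall hS hSall hW₂ hW₂all hR
    hRK hRS hRW hθ0 hθ1 hident S hβ hrem

end LimitCurrency

/-! ## §4 Road B over the Stage-B literal: all-scales × certified list × constant remainder — NO identification, NO wall -/

section RoadB

variable {θ : ℝ}

/-- **END + THE [III] LIST OVER THE STAGE-B LITERAL ON THE ALL-SCALES × CONSTANT ROAD, ALL PROFILES, (U) DERIVED** —
`AveragedAFCarrierJsBalW2.allScalesConst_END_JsBalW2Of_allProfiles_cont` at `hT₂ := T2Of_loc …`: `hβ0` + `hall` (ANY supplier) + the certified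
list `hlist : ∀ k ≤ k₁, m ≤ Sβ.β0 k` + (D4) + the ONE numeric condition `r < m − κθ^{k₁}` + (C) + run-side ⟹ `EndpointExistence Cn ∧ ∃ γ₁ > 0, …,
sizes ∧ HorizonFacts`, `β′ := Sβ.β0 0 + κ + r` DERIVED; NO identification, NO wall.  Our own derived statement. -/
theorem allScalesConst_END_JsBalT2Of_allProfiles_cont {Cn : B12.Construction} (hgen : ForwardGenerated Cn β)
    (hhalt : HaltsOutside Cn β) (hcur : CurriesHBeta Cn β) (Sβ : B12Beta.OneLoopSplit β) {μ ν : Fin 4} {κ : ℝ}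
    (hβ0 : ∀ j, Sβ.β0 j = secondMoment (TbalOf Lc (JsBalT2Of hLc cE cVH cΛ cE₂ cB T hB hmix) j) μ ν)
    (hall : AllScalesSeq (fun j => secondMoment (TbalOf Lc (JsBalT2Of hLc cE cVH cΛ cE₂ cB T hB hmix) j) μ ν) κ θ)
    {γ₀ r m : ℝ} {k₁ : ℕ} (hγ₀ : 0 < γ₀) (hlist : ∀ k, k ≤ k₁ → m ≤ Sβ.β0 k) (hrem : RemainderConst Sβ γ₀ r)
    (hr : r < m - κ * θ ^ k₁) (hcont : BetaContH γ₀ β)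
    {β₀ : ℝ} (hβ₀ : 0 < β₀) {L : ℕ} (hL2 : 2 ≤ L) (p : ℕ) {κ₀ : ℕ} (hκ : 6 ≤ κ₀) :
    EndpointExistence Cn ∧ ∃ γ₁ : ℝ, 0 < γ₁ ∧
      ∀ γ : ℝ, 0 < γ → γ ≤ min γ₀ γ₁ → ∀ Pr : B12.RunParams, (Cn Pr).flow.InInterval γ Pr.K →
        ∀ p' : ℕ, p' ≤ p → ∀ A₀ : ℝ, 0 ≤ A₀ →
          ∃ Rj : ℕ → ℕ, (∀ j, B14.IsRj L p' ((Cn Pr).flow.g j) (Rj j)) ∧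
            HorizonFacts (Cn Pr).flow (Sβ.β0 0 + κ + r) β₀ A₀ L p' κ₀ Rj Pr.K :=
  allScalesConst_END_JsBalW2Of_allProfiles_cont hLc cE cVH cΛ (T2Of_loc hLc cE cVH cΛ cE₂ cB T hB hmix) hmix hgen hhalt hcur Sβ hβ0
    hall hγ₀ hlist hrem hr hcont hβ₀ hL2 p hκ

/-- **THE [III] CARRIER OVER THE STAGE-B LITERAL ON THE ALL-SCALES × CONSTANT ROAD, DEFECT ZERO**: `BetaAvgAFH (m − κθ^{k₁} − r) 0 γ₀ β`
(`AveragedAFCarrierJsBalW2.betaAvgAFH_of_allScalesConst_JsBalW2Of` at `hT₂ := T2Of_loc …`).  Our own derived statement. -/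
theorem betaAvgAFH_of_allScalesConst_JsBalT2Of (Sβ : B12Beta.OneLoopSplit β) {μ ν : Fin 4} {κ : ℝ}
    (hβ0 : ∀ j, Sβ.β0 j = secondMoment (TbalOf Lc (JsBalT2Of hLc cE cVH cΛ cE₂ cB T hB hmix) j) μ ν)
    (hall : AllScalesSeq (fun j => secondMoment (TbalOf Lc (JsBalT2Of hLc cE cVH cΛ cE₂ cB T hB hmix) j) μ ν) κ θ)
    {γ₀ r m : ℝ} {k₁ : ℕ} (hlist : ∀ k, k ≤ k₁ → m ≤ Sβ.β0 k) (hrem : RemainderConst Sβ γ₀ r) :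
    BetaAvgAFH (m - κ * θ ^ k₁ - r) 0 γ₀ β :=
  betaAvgAFH_of_allScalesConst_JsBalW2Of hLc cE cVH cΛ (T2Of_loc hLc cE cVH cΛ cE₂ cB T hB hmix) hmix Sβ hβ0 hall hlist hrem

end RoadB

end Summit.QuantumFields.BalabanUV.Beta.AveragedAFCarrierJsBalT2

end
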